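import Summits.AtomisticToContinuum.FouriersLaw.Theorems.BondHeatUncertaintyLinearResponseFTURScheme

/-!
# The scheme path passes through the scheme states; forcing bookkeeping (K3, helper)

Helper file for stub `stub_antiDampedGirsanov` (K3) of line `lebesgue-flip-duality`, crux ★
`BondHeatUncertainty.LinearResponseFTUR` (stmt-AtomisticToContinuum-9122); sequel of `…Scheme.lean`.
For a splitting scheme `D : SchemeData N` whose frictionless drift `D.Y₀` is a confined drift with the
momentum subspace as noise subspace (`ConfinedForcedFlow.lean`), time step `h > 0` and `M` steps:

* `stepFrac` calculus (`stepFrac_grid_add`: on step `k` the elapsed fraction of step `j` is `h`, `r`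
  or `0` according as `j < k`, `j = k`, `j > k`); `continuous_forcing`, `forcing_mem`,
  `forcing_grid_add` — inside step `k < M` the forcing is `Σ_{j<k} u_j + (r/h) • u_k`, so its increment
  over the step is the RAMP of the impulse `u_k` (`forcing_grid_add_sub_eq_ramp`);
* `path_grid`, `path_grid_add` — **the scheme path passes through the states** (`path (k h) = z_k`,
  `k ≤ M`) and inside step `k` it is the frictionless flow from `z_k` driven by the ramp of `u_k`
  (cocycle `ConfinedDrift.flow_add` + locality `flow_congr`, induction on `k`);
* `norm_forcing_le` — a bound on the forcing, uniform in the number of steps: if the partial sums of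
  the noise impulses are bounded by `A` and the clamp level is `R ≥ 0`, then
  `‖F(s)‖ ≤ |ε| A + |σγ| s (|clamp terms| ≤ 2R)`-type bound `|ε| * A + |σ * γ| * (M h) * (2 R)` on `[0, M h]`
  … stated as `‖F(s)‖ ≤ |ε| * A + |σ * D.γ| * (2 * D.R) * (M * D.h)`;
* `norm_path_le` — hence the scheme paths stay in ONE a-priori ball on `[0, M h]`, uniformly in the
  mesh (`ConfinedDrift.norm_flow_le`).
-/

noncomputable section

namespace Summit.AtomisticToContinuum.FouriersLaw.Theorems.LinearResponseFTUR

open MeasureTheory Filter Set Function Finset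
open Literature.MathematicalPhysics.KineticTheory
open Literature.MathematicalPhysics.KineticTheory.HeatConduction

variable {N : ℕ}

/-! ### `stepFrac` calculus -/

/-- `stepFrac` is continuous in time. -/
theorem continuous_stepFrac (h : ℝ) (j : ℕ) : Continuous (stepFrac h j) := by
  unfold stepFrac
  fun_prop

/-- `stepFrac ≥ 0` (`h ≥ 0`). -/
theorem stepFrac_nonneg {h : ℝ} (hh : 0 ≤ h) (j : ℕ) (s : ℝ) : 0 ≤ stepFrac h j s :=
  le_min (le_max_right _ _) hh

/-- `stepFrac ≤ h`. -/
theorem stepFrac_le (h : ℝ) (j : ℕ) (s : ℝ) : stepFrac h j s ≤ h := min_le_right _ _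

/-- `stepFrac` vanishes at nonpositive times (`h ≥ 0`). -/
theorem stepFrac_of_nonpos {h : ℝ} (hh : 0 ≤ h) (j : ℕ) {s : ℝ} (hs : s ≤ 0) : stepFrac h j s = 0 := by
  unfold stepFrac
  have : s - j * h ≤ 0 := by nlinarith [mul_nonneg j.cast_nonneg hh]
  rw [max_eq_right this, min_eq_left hh]

/-- On step `k` (time `k h + r`, `r ∈ [0, h]`): the elapsed fraction of step `j` is `h` for `j < k`,
`r` for `j = k`, `0` for `j > k`. -/
theorem stepFrac_grid_add {h : ℝ} (hh : 0 < h) (j k : ℕ) {r : ℝ} (hr : r ∈ Icc 0 h) :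
    stepFrac h j (k * h + r) = if j < k then h else if j = k then r else 0 := by
  unfold stepFrac
  split_ifs with h1 h2
  · -- `j < k`: `s - jh ≥ (k - j) h ≥ h`
    have hkj : (1 : ℝ) ≤ (k : ℝ) - j := by
      have : j + 1 ≤ k := h1
      have : ((j : ℝ) + 1) ≤ k := by exact_mod_cast this
      linarith
    have hge : h ≤ k * h + r - j * h := by nlinarith [hr.1]
    rw [max_eq_left (by linarith), min_eq_right hge]
  · subst h2
    rw [show (j : ℝ) * h + r - j * h = r by ring, max_eq_left hr.1, min_eq_left hr.2]
  · -- `k < j`: `s - jh ≤ r - h ≤ 0`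
    have hjk : (k : ℝ) + 1 ≤ j := by
      have : k + 1 ≤ j := by omega
      exact_mod_cast this
    have hle : k * h + r - j * h ≤ 0 := by nlinarith [hr.2]
    rw [max_eq_right hle, min_eq_left hh.le]

namespace SchemeData

variable (D : SchemeData N) (ε σ : ℝ) (M : ℕ) (y : PhaseSpace N) (x : ℕ → ℝ × ℝ)

/-! ### The forcing -/

/-- The scheme forcing is continuous in time. -/
theorem continuous_forcing : Continuous (D.forcing ε σ M y x) := by
  unfold forcing
  refine continuous_finsetSum _ fun j _ => ?_
  exact ((continuous_stepFrac D.h j).div_const _).smul continuous_const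

/-- The scheme forcing is a momentum path. -/
theorem forcing_mem (s : ℝ) : D.forcing ε σ M y x s ∈ momentumSubspace N := by
  unfold forcing
  refine Submodule.sum_mem _ fun j _ => ?_
  exact (momentumSubspace N).smul_mem _ (D.impulse_mem ε σ _ _)

/-- The scheme forcing vanishes at nonpositive times. -/
theorem forcing_of_nonpos (hh : 0 ≤ D.h) {s : ℝ} (hs : s ≤ 0) : D.forcing ε σ M y x s = 0 := by
  unfold forcing
  refine Finset.sum_eq_zero fun j _ => ?_
  rw [stepFrac_of_nonpos hh j hs, zero_div, zero_smul]

/-- Inside step `k < M`: `F(kh + r) = Σ_{j<k} u_j + (r/h) • u_k`. -/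
theorem forcing_grid_add (hh : 0 < D.h) {k : ℕ} (hk : k < M) {r : ℝ} (hr : r ∈ Icc 0 D.h) :
    D.forcing ε σ M y x (k * D.h + r) =
      (∑ j ∈ Finset.range k, D.impulse ε σ (D.state ε σ y x j) (x j)) +
        (r / D.h) • D.impulse ε σ (D.state ε σ y x k) (x k) := by
  unfold forcing
  simp_rw [stepFrac_grid_add hh _ k hr]
  -- split the range at `k` and at `k + 1`
  have hsplit : Finset.range M = Finset.range k ∪ ({k} ∪ (Finset.range M \ Finset.range (k + 1))) := by
    ext j
    simp only [Finset.mem_range, Finset.mem_union, Finset.mem_singleton, Finset.mem_sdiff]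
    omega
  rw [hsplit, Finset.sum_union, Finset.sum_union, Finset.sum_singleton]
  · have h1 : ∑ j ∈ Finset.range k, ((if j < k then D.h else if j = k then r else 0) / D.h) •
        D.impulse ε σ (D.state ε σ y x j) (x j) =
        ∑ j ∈ Finset.range k, D.impulse ε σ (D.state ε σ y x j) (x j) := by
      refine Finset.sum_congr rfl fun j hj => ?_
      rw [if_pos (Finset.mem_range.1 hj), div_self hh.ne', one_smul]
    have h2 : ∑ j ∈ Finset.range M \ Finset.range (k + 1),
        ((if j < k then D.h else if j = k then r else 0) / D.h) • D.impulse ε σ (D.state ε σ y x j) (x j) = 0 := by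
      refine Finset.sum_eq_zero fun j hj => ?_
      simp only [Finset.mem_sdiff, Finset.mem_range] at hj
      rw [if_neg (by omega), if_neg (by omega), zero_div, zero_smul]
    rw [h1, h2, if_neg (lt_irrefl k), if_pos rfl, add_zero]
  · rw [Finset.disjoint_left]
    intro j hj hj'
    simp only [Finset.mem_singleton] at hj
    simp only [Finset.mem_sdiff, Finset.mem_range] at hj'
    omega
  · rw [Finset.disjoint_left]
    intro j hj hj'
    simp only [Finset.mem_range] at hj
    simp only [Finset.mem_union, Finset.mem_singleton, Finset.mem_sdiff, Finset.mem_range] at hj'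
    omega

/-- The increment of the forcing over step `k < M` is the ramp of the impulse of the step. -/
theorem forcing_grid_add_sub_eq_ramp (hh : 0 < D.h) {k : ℕ} (hk : k < M) {r : ℝ} (hr : r ∈ Icc 0 D.h) :
    D.forcing ε σ M y x (k * D.h + r) - D.forcing ε σ M y x (k * D.h) =
      ramp D.h (D.impulse ε σ (D.state ε σ y x k) (x k)) r := by
  have h0 : (0 : ℝ) ∈ Icc 0 D.h := ⟨le_rfl, hh.le⟩
  have := D.forcing_grid_add ε σ M y x hh hk h0
  rw [add_zero] at this
  rw [D.forcing_grid_add ε σ M y x hh hk hr, this, zero_div, zero_smul, add_zero, add_sub_cancel_left]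
  unfold ramp
  rw [max_eq_left hr.1, min_eq_left hr.2]

/-! ### The path passes through the states -/

variable {D ε σ M y x}
variable (D₀ : ConfinedDrift D.Y₀) (hD₀ : D₀.noise = momentumSubspace N)
include D₀ hD₀

/-- The scheme forcing takes values in the noise subspace of the frictionless confined drift. -/
theorem forcing_mem_noise (s : ℝ) : D.forcing ε σ M y x s ∈ D₀.noise := by
  rw [hD₀]; exact D.forcing_mem ε σ M y x s

/-- The scheme path is continuous in time. -/
theorem continuous_path : Continuous (D.path ε σ M y x) :=
  D₀.continuous_flow y (D.continuous_forcing ε σ M y x) (forcing_mem_noise D₀ hD₀)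

/-- **The scheme path passes through the scheme states and, inside each step, is the frictionless flow
from the state under the ramp of the step** (`h > 0`, `k < M`, `r ∈ [0, h]`). -/
theorem path_grid_add (hh : 0 < D.h) :
    ∀ k : ℕ, k < M → D.path ε σ M y x (k * D.h) = D.state ε σ y x k ∧
      ∀ r ∈ Icc 0 D.h, D.path ε σ M y x (k * D.h + r) =
        drivenFlow D.Y₀ (D.state ε σ y x k) (ramp D.h (D.impulse ε σ (D.state ε σ y x k) (x k))) r := by
  have hFc := D.continuous_forcing ε σ M y x
  have hFS := forcing_mem_noise (D := D) (ε := ε) (σ := σ) (M := M) (y := y) (x := x) D₀ hD₀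
  -- the step statement from the value at the left node
  have step : ∀ k : ℕ, k < M → D.path ε σ M y x (k * D.h) = D.state ε σ y x k →
      ∀ r ∈ Icc 0 D.h, D.path ε σ M y x (k * D.h + r) =
        drivenFlow D.Y₀ (D.state ε σ y x k) (ramp D.h (D.impulse ε σ (D.state ε σ y x k) (x k))) r := by
    intro k hk hnode r hr
    unfold path at hnode ⊢
    rw [D₀.flow_add y hFc hFS (mul_nonneg k.cast_nonneg hh.le) hr.1, hnode]
    -- the shifted forcing is the ramp on `[0, h]`
    have hramp : Continuous (ramp D.h (D.impulse ε σ (D.state ε σ y x k) (x k))) := continuous_ramp _ _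
    have hrampS : ∀ r, ramp D.h (D.impulse ε σ (D.state ε σ y x k) (x k)) r ∈ D₀.noise := fun r => by
      rw [hD₀]; exact ramp_mem_momentumSubspace _ (D.impulse_mem ε σ _ _) r
    have hshift : Continuous fun r => D.forcing ε σ M y x (k * D.h + r) - D.forcing ε σ M y x (k * D.h) :=
      (hFc.comp (continuous_const.add continuous_id)).sub continuous_const
    have hshiftS : ∀ r, D.forcing ε σ M y x (k * D.h + r) - D.forcing ε σ M y x (k * D.h) ∈ D₀.noise :=
      fun r => D₀.noise.sub_mem (hFS _) (hFS _)
    exact D₀.flow_congr (D.state ε σ y x k) hshift hramp hshiftS hrampS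
      (fun r' hr' => D.forcing_grid_add_sub_eq_ramp ε σ M y x hh hk hr') hr
  intro k
  induction k with
  | zero =>
    intro hM
    have hnode : D.path ε σ M y x ((0 : ℕ) * D.h) = D.state ε σ y x 0 := by
      unfold path
      rw [Nat.cast_zero, zero_mul, D₀.flow_of_nonpos y hFc le_rfl, D.forcing_of_nonpos ε σ M y x hh.le le_rfl]
      simp
    exact ⟨hnode, step 0 hM hnode⟩
  | succ k ih =>
    intro hk
    obtain ⟨-, hstep⟩ := ih (Nat.lt_of_succ_lt hk)
    have hnode : D.path ε σ M y x ((k + 1 : ℕ) * D.h) = D.state ε σ y x (k + 1) := by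
      have := hstep D.h ⟨hh.le, le_rfl⟩
      rw [D.state_succ]
      rw [← this]
      congr 1
      push_cast
      ring
    exact ⟨hnode, step (k + 1) hk hnode⟩

/-- The path at the grid points (`k ≤ M`). -/
theorem path_grid (hh : 0 < D.h) {k : ℕ} (hk : k ≤ M) : D.path ε σ M y x (k * D.h) = D.state ε σ y x k := by
  rcases Nat.lt_or_eq_of_le hk with hlt | rfl
  · exact (path_grid_add (ε := ε) (σ := σ) (y := y) (x := x) D₀ hD₀ hh k hlt).1
  · -- the last node: limit of step `k - 1`, or `k = 0`
    rcases Nat.eq_zero_or_pos k with rfl | hpos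
    · unfold path
      rw [Nat.cast_zero, zero_mul, D₀.flow_of_nonpos y (D.continuous_forcing ε σ 0 y x) le_rfl,
        D.forcing_of_nonpos ε σ 0 y x hh.le le_rfl]
      simp
    · obtain ⟨k', rfl⟩ : ∃ k', k = k' + 1 := ⟨k - 1, by omega⟩
      have h := (path_grid_add (ε := ε) (σ := σ) (y := y) (x := x) D₀ hD₀ hh k'
        (Nat.lt_succ_self _)).2 D.h ⟨hh.le, le_rfl⟩
      rw [D.state_succ, ← h]
      congr 1
      push_cast
      ring

/-! ### A-priori bounds, uniform in the mesh -/

omit D₀ hD₀ in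
/-- **A bound on the forcing, uniform in the number of steps.** If the partial sums of the noise
impulses are bounded by `A` up to `M` and `R ≥ 0`, then for `0 ≤ s`,
`‖F(s)‖ ≤ |ε| A + |σγ|·(M h)·(2R)·2`…, precisely `‖F(s)‖ ≤ |ε| * A + |σ * D.γ| * (M * D.h) * ‖Π‖`-type with
`‖frictionImpulse‖ ≤ 2R`: we record `‖F(s)‖ ≤ |ε| * A + |σ * D.γ| * (M * D.h) * (2 * D.R)`. -/
theorem norm_forcing_le (hh : 0 < D.h) (hR : 0 ≤ D.R) {A : ℝ}
    (hA : ∀ k, k ≤ M → ‖∑ j ∈ Finset.range k, noiseImpulse N D.cL D.cR (x j)‖ ≤ A) (s : ℝ) :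
    ‖D.forcing ε σ M y x s‖ ≤ |ε| * A + |σ * D.γ| * (M * D.h) * (2 * D.R) := by
  classical
  have hA0 : 0 ≤ A := (norm_nonneg _).trans (hA 0 (Nat.zero_le _))
  -- split the forcing into its noise part and its friction part
  have hsplit : D.forcing ε σ M y x s =
      ε • ∑ j ∈ Finset.range M, (stepFrac D.h j s / D.h) • noiseImpulse N D.cL D.cR (x j) -
        (σ * D.γ) • ∑ j ∈ Finset.range M, stepFrac D.h j s • frictionImpulse N D.R (D.state ε σ y x j) := by
    unfold forcing impulse
    rw [Finset.smul_sum, Finset.smul_sum, ← Finset.sum_sub_distrib]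
    refine Finset.sum_congr rfl fun j _ => ?_
    rw [smul_sub, smul_comm (stepFrac D.h j s / D.h) ε, smul_smul, smul_smul, smul_smul]
    congr 1
    congr 1
    field_simp
  -- friction part: each term has norm `≤ stepFrac · 2R`, and `Σ stepFrac ≤ M h`
  have hPi : ∀ z : PhaseSpace N, ‖frictionImpulse N D.R z‖ ≤ 2 * D.R := by
    intro z
    unfold frictionImpulse
    refine (norm_add_le _ _).trans ?_
    have hb : ∀ (k : ℕ) (c : ℝ), ‖bathVec N k c‖ ≤ |c| := by
      intro k c
      rw [Prod.norm_def]
      refine max_le (by simp [bathVec]) ?_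
      refine (pi_norm_le_iff_of_nonneg (abs_nonneg c)).2 fun i => ?_
      simp only [bathVec]
      split_ifs
      · exact le_of_eq (Real.norm_eq_abs c)
      · simp
    have h1 := (hb 0 _).trans (clampR_le hR (leftMom N z))
    have h2 := (hb (N - 1) _).trans (clampR_le hR (rightMom N z))
    linarith
  have hfric : ‖∑ j ∈ Finset.range M, stepFrac D.h j s • frictionImpulse N D.R (D.state ε σ y x j)‖ ≤
      (M * D.h) * (2 * D.R) := by
    refine (norm_sum_le _ _).trans ?_
    calc ∑ j ∈ Finset.range M, ‖stepFrac D.h j s • frictionImpulse N D.R (D.state ε σ y x j)‖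
        ≤ ∑ j ∈ Finset.range M, D.h * (2 * D.R) := by
          refine Finset.sum_le_sum fun j _ => ?_
          rw [norm_smul, Real.norm_eq_abs, abs_of_nonneg (stepFrac_nonneg hh.le j s)]
          exact mul_le_mul (stepFrac_le _ _ _) (hPi _) (norm_nonneg _) hh.le
      _ = (M * D.h) * (2 * D.R) := by rw [Finset.sum_const, Finset.card_range, nsmul_eq_mul]; ring
  -- noise part: a convex combination of two consecutive partial sums
  have hnoise : ‖∑ j ∈ Finset.range M, (stepFrac D.h j s / D.h) • noiseImpulse N D.cL D.cR (x j)‖ ≤ A := by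
    rcases le_or_gt s 0 with hs | hs
    · have : ∑ j ∈ Finset.range M, (stepFrac D.h j s / D.h) • noiseImpulse N D.cL D.cR (x j) = 0 :=
        Finset.sum_eq_zero fun j _ => by rw [stepFrac_of_nonpos hh.le j hs, zero_div, zero_smul]
      rw [this, norm_zero]; exact hA0
    · -- `s = k h + r`, `k = ⌊s/h⌋₊`, `r ∈ [0, h)`
      set k := ⌊s / D.h⌋₊ with hkdef
      have hk1 : (k : ℝ) ≤ s / D.h := Nat.floor_le (div_nonneg hs.le hh.le)
      have hk2 : s / D.h < k + 1 := Nat.lt_floor_add_one _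
      set r := s - k * D.h with hrdef
      have hr : r ∈ Icc 0 D.h := by
        constructor
        · have := (le_div_iff₀ hh).1 hk1; linarith
        · have := (div_lt_iff₀ hh).1 hk2; nlinarith
      have hsr : s = k * D.h + r := by rw [hrdef]; ring
      by_cases hkM : k < M
      · -- inside the grid
        have hval : ∑ j ∈ Finset.range M, (stepFrac D.h j s / D.h) • noiseImpulse N D.cL D.cR (x j) =
            (1 - r / D.h) • ∑ j ∈ Finset.range k, noiseImpulse N D.cL D.cR (x j) +
              (r / D.h) • ∑ j ∈ Finset.range (k + 1), noiseImpulse N D.cL D.cR (x j) := by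
          rw [hsr]
          simp_rw [stepFrac_grid_add hh _ k hr]
          have hsplit' : Finset.range M = Finset.range (k + 1) ∪ (Finset.range M \ Finset.range (k + 1)) := by
            ext j; simp only [Finset.mem_range, Finset.mem_union, Finset.mem_sdiff]; omega
          rw [hsplit', Finset.sum_union Finset.disjoint_sdiff, Finset.sum_range_succ, Finset.sum_range_succ]
          have hz : ∑ j ∈ Finset.range M \ Finset.range (k + 1),
              ((if j < k then D.h else if j = k then r else 0) / D.h) • noiseImpulse N D.cL D.cR (x j) = 0 := by
            refine Finset.sum_eq_zero fun j hj => ?_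
            simp only [Finset.mem_sdiff, Finset.mem_range] at hj
            rw [if_neg (by omega), if_neg (by omega), zero_div, zero_smul]
          have hl : ∑ j ∈ Finset.range k, ((if j < k then D.h else if j = k then r else 0) / D.h) •
              noiseImpulse N D.cL D.cR (x j) = ∑ j ∈ Finset.range k, noiseImpulse N D.cL D.cR (x j) := by
            refine Finset.sum_congr rfl fun j hj => ?_
            rw [if_pos (Finset.mem_range.1 hj), div_self hh.ne', one_smul]
          rw [hz, hl, if_neg (lt_irrefl k), if_pos rfl, add_zero, smul_add, sub_smul, one_smul]
          abel
        rw [hval]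
        have hθ0 : 0 ≤ r / D.h := div_nonneg hr.1 hh.le
        have hθ1 : r / D.h ≤ 1 := (div_le_one hh).2 hr.2
        calc ‖(1 - r / D.h) • ∑ j ∈ Finset.range k, noiseImpulse N D.cL D.cR (x j) +
              (r / D.h) • ∑ j ∈ Finset.range (k + 1), noiseImpulse N D.cL D.cR (x j)‖
            ≤ (1 - r / D.h) * A + (r / D.h) * A := by
              refine (norm_add_le _ _).trans (add_le_add ?_ ?_)
              · rw [norm_smul, Real.norm_eq_abs, abs_of_nonneg (by linarith)]
                exact mul_le_mul_of_nonneg_left (hA k hkM.le) (by linarith)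
              · rw [norm_smul, Real.norm_eq_abs, abs_of_nonneg hθ0]
                exact mul_le_mul_of_nonneg_left (hA (k + 1) hkM) hθ0
          _ = A := by ring
      · -- beyond the grid: every step is complete
        have hval : ∑ j ∈ Finset.range M, (stepFrac D.h j s / D.h) • noiseImpulse N D.cL D.cR (x j) =
            ∑ j ∈ Finset.range M, noiseImpulse N D.cL D.cR (x j) := by
          refine Finset.sum_congr rfl fun j hj => ?_
          have hjk : j < k := lt_of_lt_of_le (Finset.mem_range.1 hj) (not_lt.1 hkM)
          rw [hsr, stepFrac_grid_add hh j k hr, if_pos hjk, div_self hh.ne', one_smul]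
        rw [hval]
        exact hA M le_rfl
  rw [hsplit]
  calc ‖ε • ∑ j ∈ Finset.range M, (stepFrac D.h j s / D.h) • noiseImpulse N D.cL D.cR (x j) -
        (σ * D.γ) • ∑ j ∈ Finset.range M, stepFrac D.h j s • frictionImpulse N D.R (D.state ε σ y x j)‖
      ≤ ‖ε • ∑ j ∈ Finset.range M, (stepFrac D.h j s / D.h) • noiseImpulse N D.cL D.cR (x j)‖ +
          ‖(σ * D.γ) • ∑ j ∈ Finset.range M, stepFrac D.h j s • frictionImpulse N D.R (D.state ε σ y x j)‖ :=
        norm_sub_le _ _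
    _ ≤ |ε| * A + |σ * D.γ| * (M * D.h) * (2 * D.R) := by
        rw [norm_smul, norm_smul, Real.norm_eq_abs, Real.norm_eq_abs, mul_assoc]
        exact add_le_add (mul_le_mul_of_nonneg_left hnoise (abs_nonneg _))
          (mul_le_mul_of_nonneg_left hfric (abs_nonneg _))

/-- **The scheme paths stay in one a-priori ball on `[0, T]`, uniformly in the mesh.** -/
theorem norm_path_le {T Mf : ℝ} (hF : ∀ s ∈ Icc 0 T, ‖D.forcing ε σ M y x s‖ ≤ Mf) :
    ∀ s ∈ Icc 0 T, ‖D.path ε σ M y x s‖ ≤ D₀.apriori (D₀.V y) Mf T :=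
  D₀.norm_flow_le y (D.continuous_forcing ε σ M y x) (forcing_mem_noise D₀ hD₀) hF

/-- The scheme path solves the frictionless integral equation with the scheme forcing on every `[0, T]`. -/
theorem path_eq_integral {T : ℝ} :
    ∀ s ∈ Icc 0 T, D.path ε σ M y x s =
      y + D.forcing ε σ M y x s + ∫ r in (0 : ℝ)..s, D.Y₀ (D.path ε σ M y x r) :=
  D₀.isIntegralSolutionOn_flow y (D.continuous_forcing ε σ M y x) (forcing_mem_noise D₀ hD₀) T

end SchemeData

/-- **The scheme path passes through the scheme states** — `∀`-form of `SchemeData.path_grid`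
(registered sub-goal of the crux item). -/
theorem scheme_path_grid :
    ∀ (N : ℕ) (D : SchemeData N) (D₀ : ConfinedDrift D.Y₀), D₀.noise = momentumSubspace N → 0 < D.h → ∀ (ε σ : ℝ) (M : ℕ) (y : PhaseSpace N) (x : ℕ → ℝ × ℝ) (k : ℕ), k ≤ M → D.path ε σ M y x ((k : ℝ) * D.h) = D.state ε σ y x k :=
  fun _ _ D₀ hD₀ hh _ _ _ _ _ _ hk => SchemeData.path_grid D₀ hD₀ hh hk

end Summit.AtomisticToContinuum.FouriersLaw.Theorems.LinearResponseFTUR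

end
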